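import Summits.HubbardSuperconductivity.HubbardSuperconductivity.Theorems.AnisotropyChordTransferBlockMinima

/-!
# Route `AnisotropyChord` / H0 rotor rung, route (1): THEOREM L1 and the strict / unique THEOREM Z⁺ ON THE EVEN TORUS — the rotated
# package (original-frame Perron facts, the frame, and the hypotheses of the two-block core)

Theory seat `hubbard-h0-rotor-theory-1` g12 (THEOREM-L1.md, memo ROTOR-THEORY-12 §178/§181).  For `H(Δ) = xxzHamiltonian 1 (torusGraph 2 L) (−1) Δ`,
`L` even, `|Δ| < 1`, and the sector-`0` Perron amplitude `a₀`:

* original frame: `E(0)` IS the ground energy and bounds the quadratic form (`sectorE_zero_eq_minEnergyOn`, `sectorE_zero_mul_le`);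
  a Perron amplitude of a sector `M ≠ 0` and its global flip have disjoint supports (`perron_mul_flipAll_eq_zero`); `a₀` is flip invariant
  (`perron_zero_comp_flipAll`); `Sʸ_tot = (S⁺_tot − S⁻_tot)/(2i)` and `(Sᶻ_tot)² Sʸ_tot v = Sʸ_tot v` on `𝓗_0` (`sz_sz_sy_mulVec_of_mem_zero`);
* the rotated `Sˣ_tot` acts by single flips with weight `½` (`totalSpin_one_zero_mulVec`);
* `exists_rotated_package`: a unitary `U` (the tree's frame change) with `U H Uᴴ = H'(1,Δ,1)`, `U Sᶻ_tot Uᴴ = −Sʸ_tot`, `U Sʸ_tot Uᴴ = Sˣ_tot`,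
  `U(⨂σˣ)Uᴴ = ⨂(−σᶻ)`, together with the facts about `P = U a₀` that the two-block core (`…TransferTwoBlock`) consumes: `P ≠ 0`, even-supported,
  `H' P = E(0) P`, `Sʸ_tot P = 0`, `Sʸ_tot² (Sˣ_tot P) = Sˣ_tot P`, and `E(0)` bounds the quadratic form of `H'`;
* `parityComponents_ne_zero`: for a Perron amplitude `a` of a sector `M ≠ 0`, both parity components of `U a` are non-zero.

Prover seat `hubbard-h0-rotor-p1` g14.  All folklore.
-/

set_option linter.dupNamespace false
set_option autoImplicit false

noncomputable section

open Finset Matrix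
open scoped ComplexOrder
open Literature.MathematicalPhysics.QuantumLattice Literature.MathematicalPhysics.QuantumLattice.SpinOperators
open Literature.Probability.LatticeModels
open Summit.HubbardSuperconductivity.HubbardSuperconductivity.Theorems.AnisotropyChord.InsertionEntropy
open Summit.HubbardSuperconductivity.HubbardSuperconductivity.Theorems.AnisotropyChord.Tower

namespace Summit.HubbardSuperconductivity.HubbardSuperconductivity.Theorems.AnisotropyChord.Transfer

/-! ## Original-frame facts -/

section Orig

variable (L : ℕ) [NeZero L]

/-- **`E(0)` is the ground energy and bounds the quadratic form** (THEOREM Z⁺, wave 1: the ground vector in `Sᶻ_tot = 0`). [folklore] -/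
theorem sectorE_zero_eq_minEnergyOn (hL : Even L) {Δ : ℝ} (hΔ : |Δ| < 1) {a₀ : TensorIndex (TorusSite 2 L) 2 → ℝ}
    (ha₀ : IsPerronSectorGroundAmplitude L Δ 0 a₀) :
    sectorE L Δ 0 = (xxzHamiltonian 1 (torusGraph 2 L) (-1) Δ).minEnergyOn ⊤ ∧
    ∀ v : TensorIndex (TorusSite 2 L) 2 → ℂ,
      sectorE L Δ 0 * (star v ⬝ᵥ v).re ≤ (star v ⬝ᵥ xxzHamiltonian 1 (torusGraph 2 L) (-1) Δ *ᵥ v).re := by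
  obtain ⟨u, hu0, hE, hHu, hSzu⟩ := exists_groundVector_sectorZero L hL hΔ
  have hH : (xxzHamiltonian 1 (torusGraph 2 L) (-1) Δ).IsHermitian := xxzHamiltonian_isHermitian 1 (torusGraph 2 L) (-1) Δ
  have humem : u ∈ spinZSector (Λ := TorusSite 2 L) 1 (0 : ℝ) := by
    rw [spinZSector, Module.End.mem_eigenspace_iff, Matrix.toLin'_apply, hSzu, Complex.ofReal_zero, zero_smul]
  have h0 : sectorE L Δ 0 ≤ (xxzHamiltonian 1 (torusGraph 2 L) (-1) Δ).minEnergyOn ⊤ := by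
    have h := minEnergyOn_mul_le_re_rayleigh hH (spinZSector (Λ := TorusSite 2 L) 1 (0 : ℝ)) humem
    rw [hHu, dotProduct_smul, smul_eq_mul, Complex.re_ofReal_mul] at h
    exact le_of_mul_le_mul_right h (EigenvalueContinuation.re_star_dotProduct_self_pos hu0)
  have h1 : (xxzHamiltonian 1 (torusGraph 2 L) (-1) Δ).minEnergyOn ⊤ ≤ sectorE L Δ 0 := by
    have h := hE (fun σ => (a₀ σ : ℂ))
    rw [ha₀.eigen, dotProduct_smul, smul_eq_mul, Complex.re_ofReal_mul, PerronFrobenius.re_star_dotProduct_self_real] at h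
    have hunit : ∑ σ, a₀ σ * a₀ σ = 1 := by rw [← ha₀.unit]; exact Finset.sum_congr rfl fun σ _ => (sq (a₀ σ)).symm
    rw [hunit, mul_one, mul_one] at h
    exact h
  have heq := le_antisymm h0 h1
  exact ⟨heq, fun v => by rw [heq]; exact hE v⟩

/-- **a Perron amplitude of a sector `M ≠ 0` and its global flip have disjoint supports.** [folklore] -/
theorem perron_mul_flipAll_eq_zero {Δ M : ℝ} {a : TensorIndex (TorusSite 2 L) 2 → ℝ}
    (ha : IsPerronSectorGroundAmplitude L Δ M a) (hM : M ≠ 0) (σ : TensorIndex (TorusSite 2 L) 2) :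
    a σ * a (flipAll σ) = 0 := by
  by_contra h
  have h1 : a σ ≠ 0 := fun h0 => h (by rw [h0, zero_mul])
  have h2 : a (flipAll σ) ≠ 0 := fun h0 => h (by rw [h0, mul_zero])
  have e1 := perron_support ha σ h1
  have e2 := flip_support ha σ h2
  exact hM (by linarith)

/-- **the sector-`0` Perron amplitude is invariant under the global flip.** [folklore] -/
theorem perron_zero_comp_flipAll {Δ : ℝ} {a₀ : TensorIndex (TorusSite 2 L) 2 → ℝ}
    (ha₀ : IsPerronSectorGroundAmplitude L Δ 0 a₀) : a₀ ∘ flipAll = a₀ := by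
  have ha₀' : IsPerronSectorGroundAmplitude L Δ (-0) a₀ := by rw [neg_zero]; exact ha₀
  exact (perron_neg_eq_flip ha₀ ha₀').symm

end Orig

/-! ## `Sʸ_tot` on `𝓗_0`; `Sˣ_tot` as single flips -/

section Spins

variable {Λ : Type*} [Fintype Λ] [DecidableEq Λ]

/-- `Sʸ_tot = (S⁺_tot − S⁻_tot)/(2i)` (spin ½). [folklore] -/
theorem totalSpin_one_one_eq : (totalSpin 1 1 : Op Λ 2) = (1 / (2 * Complex.I)) • (raiseOn 1 Finset.univ - lowerOn 1 Finset.univ) := by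
  rw [totalSpin, raiseOn, lowerOn, ← Finset.sum_sub_distrib, Finset.smul_sum]
  refine Finset.sum_congr rfl fun x _ => ?_
  rw [siteSpin, spinVec_one, spinY, onSite_smul', onSite_sub']

/-- **`(Sᶻ_tot)² Sʸ_tot v = Sʸ_tot v` for `v ∈ 𝓗_0`** (`S⁺v ∈ 𝓗_1`, `S⁻v ∈ 𝓗_{−1}`). [folklore] -/
theorem sz_sz_sy_mulVec_of_mem_zero {v : TensorIndex Λ 2 → ℂ} (hv : v ∈ spinZSector (Λ := Λ) 1 (0 : ℝ)) :
    (totalSpin 1 2 : Op Λ 2) *ᵥ ((totalSpin 1 2 : Op Λ 2) *ᵥ ((totalSpin 1 1 : Op Λ 2) *ᵥ v)) = (totalSpin 1 1 : Op Λ 2) *ᵥ v := by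
  have hR := raiseOn_mulVec_mem (n := 1) hv
  have hLw := lowerOn_mulVec_mem (n := 1) hv
  have hzR : (totalSpin 1 2 : Op Λ 2) *ᵥ (raiseOn 1 Finset.univ *ᵥ v) = raiseOn 1 Finset.univ *ᵥ v := by
    rw [LiebMattis.totalSpin_two_mulVec_of_mem 1 hR]; simp
  have hzL : (totalSpin 1 2 : Op Λ 2) *ᵥ (lowerOn 1 Finset.univ *ᵥ v) = -(lowerOn 1 Finset.univ *ᵥ v) := by
    rw [LiebMattis.totalSpin_two_mulVec_of_mem 1 hLw]; simp
  rw [totalSpin_one_one_eq, Matrix.smul_mulVec, Matrix.sub_mulVec, Matrix.mulVec_smul, Matrix.mulVec_sub, hzR, hzL,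
    Matrix.mulVec_smul, Matrix.mulVec_sub, Matrix.mulVec_neg, hzR, hzL, neg_neg]

/-- **the spin-½ `Sˣ_tot` acts by single flips with weight `½`**: `(Sˣ_tot v)(τ) = ½ Σ_x v(τ^{(x)})`. [folklore] -/
theorem totalSpin_one_zero_mulVec (v : TensorIndex Λ 2 → ℂ) (τ : TensorIndex Λ 2) :
    ((totalSpin 1 0 : Op Λ 2) *ᵥ v) τ = (∑ x, v (flipAt x τ)) / 2 := by
  rw [totalSpin, Matrix.sum_mulVec, Finset.sum_apply, Finset.sum_div]
  refine Finset.sum_congr rfl fun x _ => ?_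
  have hdiag : ∀ k : Fin 2, spinX 1 k k = 0 := fun k => by
    rw [spinX_one_apply]; fin_cases k <;> simp
  rw [Matrix.mulVec, dotProduct, Finset.sum_eq_single (flipAt x τ)]
  · rw [siteSpin, spinVec_zero, onSite_apply_offdiag x _ hdiag, if_pos rfl, spinX_one_apply, if_pos rfl]; ring
  · intro ρ _ hρ
    rw [siteSpin, spinVec_zero, onSite_apply_offdiag x _ hdiag, if_neg hρ, zero_mul]
  · intro h; exact absurd (Finset.mem_univ _) h

end Spins

/-! ## The rotated package on the even torus -/

section Package

variable (L : ℕ) [NeZero L]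

/-- **THE ROTATED PACKAGE.**  For `L` even, `|Δ| < 1` and the sector-`0` Perron amplitude `a₀`: the tree's frame change `U` with
`U H(Δ) Uᴴ = H'(1,Δ,1)`, `U Sᶻ_tot Uᴴ = −Sʸ_tot`, `U Sʸ_tot Uᴴ = Sˣ_tot`, `U (⨂σˣ) Uᴴ = ⨂(−σᶻ)`, the global bound `E(0)` for `H'`, and the
rotated Perron vector `P = U a₀`: non-zero, even-supported, `H'P = E(0)P`, `Sʸ_tot P = 0`, `Sʸ_tot²(Sˣ_tot P) = Sˣ_tot P`. [folklore] -/
theorem exists_rotated_package (hL : Even L) {Δ : ℝ} (hΔ : |Δ| < 1) {a₀ : TensorIndex (TorusSite 2 L) 2 → ℝ}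
    (ha₀ : IsPerronSectorGroundAmplitude L Δ 0 a₀) :
    ∃ U : Op (TorusSite 2 L) 2, U * Uᴴ = 1 ∧ Uᴴ * U = 1 ∧
      U * xxzHamiltonian 1 (torusGraph 2 L) (-1) Δ * Uᴴ = xyzBondHamiltonian₃ (d := 2) L 1 1 Δ 1 ∧
      U * (totalSpin 1 2 : Op (TorusSite 2 L) 2) * Uᴴ = -(totalSpin 1 1 : Op (TorusSite 2 L) 2) ∧
      U * (totalSpin 1 1 : Op (TorusSite 2 L) 2) * Uᴴ = (totalSpin 1 0 : Op (TorusSite 2 L) 2) ∧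
      U * productOp (fun _ : TorusSite 2 L => spinHalfPauli 0) * Uᴴ = productOp (fun _ : TorusSite 2 L => -spinHalfPauli 2) ∧
      (∀ v : TensorIndex (TorusSite 2 L) 2 → ℂ,
        sectorE L Δ 0 * (star v ⬝ᵥ v).re ≤ (star v ⬝ᵥ xyzBondHamiltonian₃ (d := 2) L 1 1 Δ 1 *ᵥ v).re) ∧
      U *ᵥ (fun σ => (a₀ σ : ℂ)) ≠ 0 ∧
      (∀ σ : TensorIndex (TorusSite 2 L) 2, (∑ z, (σ z : ℕ)) % 2 ≠ 0 → (U *ᵥ fun σ => (a₀ σ : ℂ)) σ = 0) ∧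
      xyzBondHamiltonian₃ (d := 2) L 1 1 Δ 1 *ᵥ (U *ᵥ fun σ => (a₀ σ : ℂ)) = ((sectorE L Δ 0 : ℝ) : ℂ) • (U *ᵥ fun σ => (a₀ σ : ℂ)) ∧
      (totalSpin 1 1 : Op (TorusSite 2 L) 2) *ᵥ (U *ᵥ fun σ => (a₀ σ : ℂ)) = 0 ∧
      (totalSpin 1 1 : Op (TorusSite 2 L) 2) *ᵥ ((totalSpin 1 1 : Op (TorusSite 2 L) 2) *ᵥ
          ((totalSpin 1 0 : Op (TorusSite 2 L) 2) *ᵥ (U *ᵥ fun σ => (a₀ σ : ℂ)))) =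
        (totalSpin 1 0 : Op (TorusSite 2 L) 2) *ᵥ (U *ᵥ fun σ => (a₀ σ : ℂ)) := by
  obtain ⟨k, hk⟩ := hL
  have hm := card_torusSite_two_of_even L hk
  obtain ⟨U, hU, hU', hUH, hUx, hUy, hUz⟩ := exists_frame_xyzBondHamiltonian₃ (d := 2) L 1 1 1 Δ
  rw [← ham_eq_xyzBondHamiltonian₃] at hUH
  set H : Op (TorusSite 2 L) 2 := xxzHamiltonian 1 (torusGraph 2 L) (-1) Δ with hHdef
  set ca : TensorIndex (TorusSite 2 L) 2 → ℂ := fun σ => (a₀ σ : ℂ) with hca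
  have hSz : U * (totalSpin 1 2 : Op (TorusSite 2 L) 2) * Uᴴ = -(totalSpin 1 1 : Op (TorusSite 2 L) 2) := by
    rw [totalSpin, totalSpin, Finset.mul_sum, Finset.sum_mul, ← Finset.sum_neg_distrib]
    exact Finset.sum_congr rfl fun x _ => hUz x
  have hSy : U * (totalSpin 1 1 : Op (TorusSite 2 L) 2) * Uᴴ = (totalSpin 1 0 : Op (TorusSite 2 L) 2) := by
    rw [totalSpin, totalSpin, Finset.mul_sum, Finset.sum_mul]
    exact Finset.sum_congr rfl fun x _ => hUy x
  have hFlip := frame_conj_flipXOp hU hU' hUx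
  obtain ⟨hE0eq, hE0⟩ := sectorE_zero_eq_minEnergyOn L ⟨k, hk⟩ hΔ ha₀
  -- the rotated lower bound
  have hEt : ∀ v : TensorIndex (TorusSite 2 L) 2 → ℂ,
      sectorE L Δ 0 * (star v ⬝ᵥ v).re ≤ (star v ⬝ᵥ xyzBondHamiltonian₃ (d := 2) L 1 1 Δ 1 *ᵥ v).re := by
    intro v
    rw [← hUH, star_dotProduct_conj_mulVec, ← star_dotProduct_conjTranspose_mulVec hU v]
    exact hE0 _
  -- `ca` facts in the original frame
  have hca0 : ca ≠ 0 := by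
    intro h
    have : ∑ σ, a₀ σ ^ 2 = 0 := Finset.sum_eq_zero fun σ _ => by
      have := congrFun h σ
      rw [hca] at this
      simp only [Pi.zero_apply, Complex.ofReal_eq_zero] at this
      rw [this]; ring
    rw [ha₀.unit] at this; exact one_ne_zero this
  have hSzca : (totalSpin 1 2 : Op (TorusSite 2 L) 2) *ᵥ ca = 0 := by
    rw [LiebMattis.totalSpin_two_mulVec_of_mem 1 ha₀.sector, Complex.ofReal_zero, zero_smul]
  have hflipca : (fun σ => ca (fun z => 1 - σ z)) = ca := by
    funext σ
    have := congrFun (perron_zero_comp_flipAll L ha₀) σ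
    rw [hca]
    simp only [Function.comp_apply] at this ⊢
    exact congrArg _ this
  refine ⟨U, hU, hU', hUH, hSz, hSy, hFlip, hEt, mulVec_ne_zero_of_left_inverse hU' hca0, ?_, ?_, ?_, ?_⟩
  · -- even support: `⨂(−σᶻ) (U ca) = U (⨂σˣ ca) = U ca`
    intro σ hσ
    have h1 : productOp (fun _ : TorusSite 2 L => -spinHalfPauli 2) *ᵥ (U *ᵥ ca) = U *ᵥ ca := by
      have h2 : productOp (fun _ : TorusSite 2 L => -spinHalfPauli 2) * U =
          U * productOp (fun _ : TorusSite 2 L => spinHalfPauli 0) := by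
        rw [← hFlip, Matrix.mul_assoc, hU', Matrix.mul_one]
      rw [Matrix.mulVec_mulVec, h2, ← Matrix.mulVec_mulVec]
      congr 1
      funext τ
      rw [flipXOp_mulVec]
      exact congrFun hflipca τ
    have h3 := congrFun h1 σ
    rw [parityOp_mulVec hm] at h3
    have hσ1 : (∑ z, (σ z : ℕ)) % 2 = 1 := by have := Nat.mod_lt (∑ z, (σ z : ℕ)) two_pos; omega
    rw [neg_one_pow_eq_pow_mod_two (R := ℂ), hσ1, pow_one, neg_one_mul] at h3
    have : (2 : ℂ) * (U *ᵥ ca) σ = 0 := by linear_combination -h3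
    exact (mul_eq_zero.1 this).resolve_left two_ne_zero
  · rw [← hUH, conj_mulVec_mulVec hU', ha₀.eigen, Matrix.mulVec_smul]; rfl
  · have h2 : (totalSpin 1 1 : Op (TorusSite 2 L) 2) = -(U * (totalSpin 1 2 : Op (TorusSite 2 L) 2) * Uᴴ) := by
      rw [hSz, neg_neg]
    rw [h2, Matrix.neg_mulVec, conj_mulVec_mulVec hU', hSzca, Matrix.mulVec_zero, neg_zero]
  · have hYU : ∀ w : TensorIndex (TorusSite 2 L) 2 → ℂ,
        (totalSpin 1 1 : Op (TorusSite 2 L) 2) *ᵥ (U *ᵥ w) = -(U *ᵥ ((totalSpin 1 2 : Op (TorusSite 2 L) 2) *ᵥ w)) := by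
      intro w
      have h2 : (totalSpin 1 1 : Op (TorusSite 2 L) 2) = -(U * (totalSpin 1 2 : Op (TorusSite 2 L) 2) * Uᴴ) := by
        rw [hSz, neg_neg]
      rw [h2, Matrix.neg_mulVec, conj_mulVec_mulVec hU']
    rw [← hSy, conj_mulVec_mulVec hU', hYU, Matrix.mulVec_neg, hYU, neg_neg, sz_sz_sy_mulVec_of_mem_zero ha₀.sector]

/-- **both parity components of the rotated image of a sector-`M ≠ 0` Perron amplitude are non-zero** (the parity operator `⨂(−σᶻ)`
is the rotated global flip, and `a`, `a ∘ σ̄` have disjoint supports). THEOREM-L1.md (D). [folklore] -/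
theorem parityComponents_ne_zero (hL : Even L) {Δ M : ℝ} {a : TensorIndex (TorusSite 2 L) 2 → ℝ}
    (ha : IsPerronSectorGroundAmplitude L Δ M a) (hM : M ≠ 0) {U : Op (TorusSite 2 L) 2} (hU' : Uᴴ * U = 1)
    (hFlip : U * productOp (fun _ : TorusSite 2 L => spinHalfPauli 0) * Uᴴ = productOp (fun _ : TorusSite 2 L => -spinHalfPauli 2))
    (r : ℕ) (hr : r < 2) :
    (fun σ => if (∑ z, (σ z : ℕ)) % 2 = r then (U *ᵥ fun σ => (a σ : ℂ)) σ else 0) ≠ 0 := by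
  obtain ⟨k, hk⟩ := hL
  have hm := card_torusSite_two_of_even L hk
  set ca : TensorIndex (TorusSite 2 L) 2 → ℂ := fun σ => (a σ : ℂ) with hca
  set cf : TensorIndex (TorusSite 2 L) 2 → ℂ := fun σ => ca (fun z => 1 - σ z) with hcf
  -- `⨂(−σᶻ) (U ca) = U cf`
  have h1 : productOp (fun _ : TorusSite 2 L => -spinHalfPauli 2) *ᵥ (U *ᵥ ca) = U *ᵥ cf := by
    have h2 : productOp (fun _ : TorusSite 2 L => -spinHalfPauli 2) * U =
        U * productOp (fun _ : TorusSite 2 L => spinHalfPauli 0) := by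
      rw [← hFlip, Matrix.mul_assoc, hU', Matrix.mul_one]
    rw [Matrix.mulVec_mulVec, h2, ← Matrix.mulVec_mulVec]
    congr 1
    funext τ
    rw [flipXOp_mulVec]
  -- the component is `(U ca ± U cf)/2`
  set s : ℂ := (-1) ^ r with hs
  have hcomp : (fun σ => if (∑ z, (σ z : ℕ)) % 2 = r then (U *ᵥ ca) σ else 0) =
      (2 : ℂ)⁻¹ • (U *ᵥ ca + s • (U *ᵥ cf)) := by
    funext σ
    have h3 := congrFun h1 σ
    rw [parityOp_mulVec hm, neg_one_pow_eq_pow_mod_two (R := ℂ)] at h3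
    rw [Pi.smul_apply, Pi.add_apply, Pi.smul_apply, smul_eq_mul, smul_eq_mul, ← h3, hs]
    have h01 : (∑ z, (σ z : ℕ)) % 2 = 0 ∨ (∑ z, (σ z : ℕ)) % 2 = 1 := Nat.mod_two_eq_zero_or_one _
    interval_cases r <;> rcases h01 with h | h <;> simp [h] <;> ring
  -- `ca + s • cf ≠ 0` (disjoint supports), hence the component is non-zero
  obtain ⟨σ₀, hσ₀⟩ : ∃ σ₀, a σ₀ ≠ 0 := by
    by_contra h; push Not at h
    have : ∑ σ, a σ ^ 2 = 0 := Finset.sum_eq_zero fun σ _ => by rw [h σ]; ring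
    rw [ha.unit] at this; exact one_ne_zero this
  have hflip0 : a (flipAll σ₀) = 0 := by
    have := perron_mul_flipAll_eq_zero L ha hM σ₀
    exact (mul_eq_zero.1 this).resolve_left hσ₀
  have hne : ca + s • cf ≠ 0 := by
    intro h
    have h4 := congrFun h σ₀
    rw [Pi.add_apply, Pi.smul_apply, smul_eq_mul, Pi.zero_apply, hcf, hca] at h4
    simp only [] at h4
    have h5 : (a (fun z => 1 - σ₀ z) : ℂ) = 0 := by
      have : (fun z => 1 - σ₀ z) = flipAll σ₀ := rfl
      rw [this, hflip0, Complex.ofReal_zero]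
    rw [h5, mul_zero, add_zero, Complex.ofReal_eq_zero] at h4
    exact hσ₀ h4
  rw [hcomp]
  refine smul_ne_zero (inv_ne_zero two_ne_zero) ?_
  rw [← Matrix.mulVec_smul, ← Matrix.mulVec_add]
  exact mulVec_ne_zero_of_left_inverse hU' hne

end Package

end Summit.HubbardSuperconductivity.HubbardSuperconductivity.Theorems.AnisotropyChord.Transfer
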